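import Literature.AnabelianGeometry.SemiGraphs.PSCCuspidalCriterionProofs
import Literature.AnabelianGeometry.SemiGraphs.PSCSeparatingCoveringsProofs2
import Literature.AnabelianGeometry.SemiGraphs.PSCRamification
import HarnessLib

/-!
# [CombGC] Theorem 1.6 (i) as printed over the origin parameter: reduction at pro-`l` profinite origins

Mochizuki, *A combinatorial version of the Grothendieck conjecture*, Tohoku Math. J. **59** (2007)
[CombGC], §1, Theorem 1.6 (i), p. 13 ("`α` is numerically cuspidal if and only if it is
group-theoretically cuspidal"), proof pp. 13–14 as amended by [IUTchI] Rmk. 1.2.3 (iii)(iv)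
(kurims manuscript pp. 41–42).  PROOF-ONLY companion of `PSCGraphicity.lean` (abc-iut-L3-t4; the
printed statement over the origin parameter is `PSCDatum.NumericallyCuspidalIffHolds Ω`, abc-iut
FACT-LIST row F-0458), seat abc-iut-f-164 (FACT tranche 164).

The row is a SCHEMA over `Ω : PSCOrigin` (Def. 1.1 (i) "of pro-Σ PSC-type", never constructed): its
universal closure `∀ Ω, …` is FALSE (`not_forall_numericallyCuspidalIffHolds`,
`PSCOriginClosureRefutations.lean`) and it holds at the degenerate smooth-proper origins
(`numericallyCuspidalIffHolds_of_smoothProper`, `PSCSmoothProperOrigin.lean`).  This file records the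
complementary ORIGIN-LEVEL REDUCTION, the `Ω`-twin of the datum-level reduction
`numericallyCuspidalIff_of_characterization` (abc-iut-w4-d052, `PSCCuspidalCriterionProofs.lean`):
at every origin `Ω` all of whose data have profinite `Π` and `Σ = {l}` for one fixed prime `l` —
the case to which the printed proof reduces ("by projecting to the maximal pro-`l` quotients … we
may assume … that `Σ = {l}`", p. 13) — Theorem 1.6 (i) as printed FOLLOWS from the two named facts
the printed proof cites: Prop. 1.2 (i) as printed (`OpenInterDeterminesComponentHolds Ω`, row F-0459;
sufficiency, "immediate [cf. Proposition 1.2, (i)]", p. 13) and the characterization of cuspidal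
subgroups [IUTchI] Rmk. 1.2.3 (iv) (`CuspidalEdgeLikeCharacterizationHolds Ω`, row F-1931;
necessity, p. 14 / [IUTchI] p. 43 (vi)).  Second form: with Prop. 1.2 (i) itself derived from the
separating-coverings statement (`SeparatingCoveringsHolds Ω`, row F-2830; abc-iut-w5-d183's
`openInterDeterminesComponentHolds_of_separating`).  So at such origins F-0458 is not an
independent assumption: F-0458 ⇐ {F-0459 ∣ F-2830} + F-1931.  The general-`Σ` origin form needs in
addition the change-of-`Σ` transport of the necessity half (cell row T16-L04) and is not claimed here.
Profiniteness is a displayed inline hypothesis (Def. 1.1 (ii), p. 6: "the maximal pro-Σ quotient of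
the profinite fundamental group"), in the shape used by `PSCSeparatingCoveringsProofs2.lean`; no new
`Prop` is introduced; nothing is asserted about curves; nothing here takes a side on [IUTchIII]
Cor. 3.12. [cite: MochizukiCombGC2007, Thm 1.6(i) p.13]
-/

noncomputable section

namespace Literature.AnabelianGeometry.SemiGraphs

namespace PSCDatum

universe u

variable (Ω : PSCOrigin.{u}) (l : ℕ)

/-- **[CombGC] Theorem 1.6 (i) as printed, at a pro-`l` profinite origin, REDUCED to the facts its
proof cites**: if every datum `G` of `Ω`-PSC-type has profinite `Π_G` and `Σ_G = {l}`, then Prop. 1.2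
(i) as printed (`OpenInterDeterminesComponentHolds Ω`, F-0459) and [IUTchI] Rmk. 1.2.3 (iv)
(`CuspidalEdgeLikeCharacterizationHolds Ω`, F-1931) imply "`α` is numerically cuspidal if and only
if it is group-theoretically cuspidal" for all `G`, `H` of `Ω`-type and every `α : Π_G ≅ Π_H`
(`NumericallyCuspidalIffHolds Ω`, F-0458) — by abc-iut-w4-d052's datum-level
`numericallyCuspidalIff_of_characterization` (BY NAME). [cite: MochizukiCombGC2007, Thm 1.6(i) p.13] -/
theorem numericallyCuspidalIffHolds_of_characterization
    (hprof : ∀ ⦃Q : Type u⦄ [Group Q] [TopologicalSpace Q] [IsTopologicalGroup Q] (G : PSCDatum Q),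
      Ω.IsOfPSCType G → CompactSpace Q ∧ TotallyDisconnectedSpace Q)
    (hSig : ∀ ⦃Q : Type u⦄ [Group Q] [TopologicalSpace Q] [IsTopologicalGroup Q] (G : PSCDatum Q),
      Ω.IsOfPSCType G → G.Sigma = {l})
    (h12 : OpenInterDeterminesComponentHolds Ω) (hchar : CuspidalEdgeLikeCharacterizationHolds Ω) :
    NumericallyCuspidalIffHolds Ω := by
  intro Q _ _ _ Q' _ _ _ G H α hG hH
  haveI : CompactSpace Q := (hprof G hG).1
  haveI : CompactSpace Q' := (hprof H hH).1
  exact numericallyCuspidalIff_of_characterization (hSig G hG) (hSig H hH) (h12 G hG).2.1 (h12 H hH).2.1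
    (hchar G hG) (hchar H hH)

/-- **[CombGC] Theorem 1.6 (i) as printed, at a pro-`l` profinite origin, from the separating
coverings and the cuspidal characterization**: as `numericallyCuspidalIffHolds_of_characterization`,
with Prop. 1.2 (i) itself derived from `SeparatingCoveringsHolds Ω` (F-2830) by abc-iut-w5-d183's
`openInterDeterminesComponentHolds_of_separating` (BY NAME): F-0458 ⇐ F-2830 + F-1931 at such
origins. [cite: MochizukiCombGC2007, Thm 1.6(i) p.13] -/
theorem numericallyCuspidalIffHolds_of_separating
    (hprof : ∀ ⦃Q : Type u⦄ [Group Q] [TopologicalSpace Q] [IsTopologicalGroup Q] (G : PSCDatum Q),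
      Ω.IsOfPSCType G → CompactSpace Q ∧ TotallyDisconnectedSpace Q)
    (hSig : ∀ ⦃Q : Type u⦄ [Group Q] [TopologicalSpace Q] [IsTopologicalGroup Q] (G : PSCDatum Q),
      Ω.IsOfPSCType G → G.Sigma = {l})
    (hsep : SeparatingCoveringsHolds Ω) (hchar : CuspidalEdgeLikeCharacterizationHolds Ω) :
    NumericallyCuspidalIffHolds Ω :=
  numericallyCuspidalIffHolds_of_characterization Ω l hprof hSig
    (openInterDeterminesComponentHolds_of_separating Ω hsep hprof) hchar

/-- **The two halves separately, at a pro-`l` profinite origin** (for consumers binding one direction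
only): necessity "numerically cuspidal ⟹ group-theoretically cuspidal" needs only [IUTchI] Rmk. 1.2.3
(iv) (`CuspidalEdgeLikeCharacterizationHolds Ω`, F-1931) — abc-iut-w4-d052's
`isGroupTheoreticallyCuspidal_of_isNumericallyCuspidal` BY NAME; sufficiency for EVERY origin is
`numericallyCuspidal_of_groupTheoreticallyCuspidal_holds` (`PSCCuspidalCriterionProofs.lean`).
[cite: MochizukiCombGC2007, Thm 1.6(i) p.14] -/
theorem groupTheoreticallyCuspidal_of_numericallyCuspidal_holds
    (hprof : ∀ ⦃Q : Type u⦄ [Group Q] [TopologicalSpace Q] [IsTopologicalGroup Q] (G : PSCDatum Q),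
      Ω.IsOfPSCType G → CompactSpace Q ∧ TotallyDisconnectedSpace Q)
    (hSig : ∀ ⦃Q : Type u⦄ [Group Q] [TopologicalSpace Q] [IsTopologicalGroup Q] (G : PSCDatum Q),
      Ω.IsOfPSCType G → G.Sigma = {l})
    (hchar : CuspidalEdgeLikeCharacterizationHolds Ω)
    ⦃Q : Type u⦄ [Group Q] [TopologicalSpace Q] [IsTopologicalGroup Q]
    ⦃Q' : Type u⦄ [Group Q'] [TopologicalSpace Q'] [IsTopologicalGroup Q']
    (G : PSCDatum Q) (H : PSCDatum Q') (α : Q ≃ₜ* Q') (hG : Ω.IsOfPSCType G)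
    (hH : Ω.IsOfPSCType H) :
    G.IsNumericallyCuspidal H α → G.IsGroupTheoreticallyCuspidal H α := by
  haveI : CompactSpace Q := (hprof G hG).1
  haveI : CompactSpace Q' := (hprof H hH).1
  exact isGroupTheoreticallyCuspidal_of_isNumericallyCuspidal (hSig G hG) (hSig H hH) (hchar G hG)
    (hchar H hH)

end PSCDatum

end Literature.AnabelianGeometry.SemiGraphs

end
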